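import Summits.Ventures.HSemireg.WedgePointPairPowersPerQRank

/-!
# Venture HSemireg — per-`q` blocks of the `n`-fold box of `m`-dimensional point pairs, companion: THE SERRE-TYPE PALINDROME
# `rank_q = rank_{mn − k − q}` for EVERY `m ≥ 1`, `n`, `k`, and the blocks of index `> mn − k` vanish (η-weights `w ↔ −w`)

HONEST FRAMING. Part of the Lean index of the computation cell `pub-hsemireg` (seat p10 gen 4, Sunday typer «UNIFORM-IN-n»).
Finite-dimensional EXTERIOR ALGEBRA over a field and natural-number / integer polynomial arithmetic ONLY: no variety, no cohomology
theory, no sheaf, no Ext group, no semiregularity map is constructed here; nothing here says that HC / HC_CM / HC_AV holds; no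
Literature fact is declared or used.  Custodian versions: STRUCTURE.md v1.0-SIGNED 9b196a05977dd067 (§1.1 C13; (S1) «K-isotypic
pieces of weights ∓(n−k)»), theory/FORMULA-N.md PART A §4.1″ (th-6) / PART B §G (th-7, `η`-weights).  Model and dictionary (quoted,
NOT asserted): `WedgePointPairPowers.lean`; the per-`q` rank theorem `WedgePointPairPowersPerQRank.finrank_range_blockProj_wedge_pairBox`
(`rank_q = genCount m n k q = |Fset m n k q|`).

THIS FILE (the general-`m`, general-`n` form of the two-factor palindrome `WedgeBoxPerQOverlap.finrank_range_blockProj_symm`, there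
from the arithmetic `FormulaNUniformBlocks.blockCount_symm`; here by an explicit INVOLUTION ON THE CLASSES, no generating function):
§1 the letter reversal `x ↦ 2m − 1 − x` of one block (`Fin.rev`) swaps the halves `X ↔ Y`; §2 the LOCAL INVOLUTION on th-7's canonical
sources: a proper non-empty source (`0 < |t| < m`) is reversed (proper `X`-subsets ↔ proper `Y`-subsets), the empty source and the top
collapse `X` are fixed (`linv`, `oinv`; stays inside `optSet m`); the LOCAL IDENTITY `q_f(o) + q_f(ō) + m·z(o) + |o| = m`
(`lqf_add_lqf_oinv`); §3 blockwise on option data (`finv`): degree and number of empty blocks are preserved and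
**`q_f(f) + q_f(f̄) + m·z(f) + k(f) = mn`** (`qff_add_qff_finv`), so the class of `f` reaches `q = q_f + jm` iff the class of `f̄`
reaches `mn − k − q = q_f(f̄) + (z − j)m`: **`Fset m n k (mn − k − q)` is the image of `Fset m n k q` under the involution**
(`map_finv_Fset`, `card_Fset_symm`), and **no class of degree `k` reaches a block of index `> mn − k`** (`Fset_eq_empty_of_add_lt`);
§4 THE RANK STATEMENTS for every field, `m ≥ 1`, `n`, `k`, `a, c ≠ 0`: **`rank((mn − k − q)-block of θ ↦ θ ∧ F ∣ ⋀^k) = rank(q-block)`**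
for `q ≤ mn − k` (`finrank_range_blockProj_wedge_pairBox_symm`) — in th-7 §G's `η`-weights `w = mn − k − 2q` this is `w ↔ −w`, the
symmetry (S1) prints for the two isotypic pieces of ONE factor — and **`rank(q-block) = 0` for `q > mn − k`**
(`…_eq_zero_of_add_lt`); §5 the same as ARITHMETIC of p10's enumerator: `genCount m n k (mn − k − q) = genCount m n k q`,
`genCount m n k q = 0` for `k + q > mn`, `[t^k u^{mn−k−q}] G_{m,n} = [t^k u^q] G_{m,n}` (`genCount_symm`, `genCount_eq_zero_of_add_lt`,
`coeff_genGen_symm`) — kernel identities of `FormulaNPerQUniform.genGen` obtained from the involution, consistent with the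
pre-registered `m = 3`, `n = 3` rows `(9,0,9,9,0,9,9,0,9,0)`, `(36,9,54,36,36,54,9,36,0,0)`, `(84,54,135,111,135,54,84,0,0,0)`
(palindromes about `(9 − k)/2`).  Namespace `Summit.Ventures.HSemireg.Wedge.PairPowers`, new names only; nothing restated.
-/

open Module Set Set.powersetCard Polynomial

namespace Summit.Ventures.HSemireg.Wedge.PairPowers

open Summit.Ventures.HSemireg.Wedge Summit.Ventures.HSemireg.Wedge.Kunneth

variable (K : Type*) [Field K] {m : ℕ} {n : ℕ}

/-! ## §1. The letter reversal of one block swaps the halves -/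

/-- the letter reversal `x ↦ 2m − 1 − x` of one block, applied to a letter set. -/
def lrev (t : Finset (Fin (m + m))) : Finset (Fin (m + m)) := t.image Fin.rev

/-- membership in the reversed set. -/
lemma mem_lrev {t : Finset (Fin (m + m))} {x : Fin (m + m)} : x ∈ lrev t ↔ Fin.rev x ∈ t := by
  rw [lrev, Finset.mem_image]
  constructor
  · rintro ⟨y, hy, rfl⟩
    rwa [Fin.rev_rev]
  · intro h
    exact ⟨Fin.rev x, h, Fin.rev_rev x⟩

/-- reversal preserves the number of letters. -/
lemma card_lrev (t : Finset (Fin (m + m))) : (lrev t).card = t.card :=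
  Finset.card_image_of_injective t Fin.rev_injective

/-- reversal is an involution. -/
lemma lrev_lrev (t : Finset (Fin (m + m))) : lrev (lrev t) = t := by
  ext x
  rw [mem_lrev, mem_lrev, Fin.rev_rev]

/-- the reversal of an `X`-letter is a `Y`-letter. -/
lemma rev_mem_Ys_iff {x : Fin (m + m)} : Fin.rev x ∈ Ys m ↔ x ∈ Xs m := by
  rw [WedgePair.mem_Yset, WedgePair.mem_Xset, Fin.val_rev]
  have := x.2
  omega

/-- the reversal of a `Y`-letter is an `X`-letter. -/
lemma rev_mem_Xs_iff {x : Fin (m + m)} : Fin.rev x ∈ Xs m ↔ x ∈ Ys m := by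
  rw [WedgePair.mem_Yset, WedgePair.mem_Xset, Fin.val_rev]
  have := x.2
  omega

/-- the reversal of an `X`-set is a `Y`-set. -/
lemma lrev_subset_Ys {t : Finset (Fin (m + m))} (h : t ⊆ Xs m) : lrev t ⊆ Ys m :=
  fun _ hx => rev_mem_Xs_iff.mp (h (mem_lrev.mp hx))

/-- the reversal of a `Y`-set is an `X`-set. -/
lemma lrev_subset_Xs {t : Finset (Fin (m + m))} (h : t ⊆ Ys m) : lrev t ⊆ Xs m :=
  fun _ hx => rev_mem_Ys_iff.mp (h (mem_lrev.mp hx))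

/-- a non-empty letter set is not inside both halves. -/
lemma not_subset_Xs_of_subset_Ys {t : Finset (Fin (m + m))} (hY : t ⊆ Ys m) (hne : t ≠ ∅) : ¬ t ⊆ Xs m :=
  fun hX => hne (eq_empty_of_disjoint (WedgePair.disjoint_X_iff_subset_Y.mpr hY) (WedgePair.disjoint_Y_iff_subset_X.mpr hX))

/-! ## §2. The local involution on the canonical sources and the local identity -/

variable (m) in
/-- the LOCAL INVOLUTION on letter sets: reverse a proper non-empty set (`0 < |t| < m`), fix the others (in `optSet m`: `∅` and `X`). -/
def linv (t : Finset (Fin (m + m))) : Finset (Fin (m + m)) := if 0 < t.card ∧ t.card < m then lrev t else t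

/-- on a proper non-empty set the involution is the reversal. -/
lemma linv_of_proper {t : Finset (Fin (m + m))} (h : 0 < t.card ∧ t.card < m) : linv m t = lrev t := if_pos h

/-- elsewhere it is the identity. -/
lemma linv_of_not_proper {t : Finset (Fin (m + m))} (h : ¬ (0 < t.card ∧ t.card < m)) : linv m t = t := if_neg h

/-- the involution preserves the number of letters. -/
lemma card_linv (t : Finset (Fin (m + m))) : (linv m t).card = t.card := by
  by_cases h : 0 < t.card ∧ t.card < m
  · rw [linv_of_proper h, card_lrev]
  · rw [linv_of_not_proper h]

/-- it is an involution. -/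
lemma linv_linv (t : Finset (Fin (m + m))) : linv m (linv m t) = t := by
  by_cases h : 0 < t.card ∧ t.card < m
  · have h' : 0 < (lrev t).card ∧ (lrev t).card < m := by rwa [card_lrev]
    rw [linv_of_proper h, linv_of_proper h', lrev_lrev]
  · rw [linv_of_not_proper h, linv_of_not_proper h]

/-- it preserves emptiness. -/
lemma linv_eq_empty_iff (t : Finset (Fin (m + m))) : linv m t = ∅ ↔ t = ∅ := by
  rw [← Finset.card_eq_zero, card_linv, Finset.card_eq_zero]

/-- it maps canonical sources to canonical sources (proper `X`-subsets ↔ proper `Y`-subsets; `∅`, `X` fixed). -/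
lemma linv_mem_optSet {t : Finset (Fin (m + m))} (ht : t ∈ optSet m) : linv m t ∈ optSet m := by
  rw [mem_optSet] at ht ⊢
  by_cases h : 0 < t.card ∧ t.card < m
  · rw [linv_of_proper h]
    rcases ht with hX | ⟨hY, -⟩
    · exact Or.inr ⟨lrev_subset_Ys hX, by rw [card_lrev]; exact h⟩
    · exact Or.inl (lrev_subset_Xs hY)
  · rw [linv_of_not_proper h]
    rcases ht with hX | ⟨_, hc⟩
    · exact Or.inl hX
    · exact absurd hc h

/-- the LOCAL INVOLUTION on th-7's canonical sources `Opt m`. -/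
def oinv (o : Opt m) : Opt m := ⟨linv m o.1, linv_mem_optSet o.2⟩

/-- its underlying letter set. -/
lemma oinv_val (o : Opt m) : (oinv o).1 = linv m o.1 := rfl

/-- it is an involution. -/
lemma oinv_oinv (o : Opt m) : oinv (oinv o) = o := Subtype.ext (by rw [oinv_val, oinv_val, linv_linv])

/-- it preserves the number of letters. -/
lemma card_oinv (o : Opt m) : ((oinv o).1).card = (o.1).card := by rw [oinv_val, card_linv]

/-- it preserves the empty-block indicator. -/
lemma lz_oinv (o : Opt m) : lz m (oinv o) = lz m o := by
  unfold lz
  exact if_congr (linv_eq_empty_iff o.1) rfl rfl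

/-- a canonical source has at most `m` letters. -/
lemma card_le_of_opt (o : Opt m) : (o.1).card ≤ m := by
  rcases mem_optSet.mp o.2 with hX | ⟨-, -, hc⟩
  · exact (Finset.card_le_card hX).trans (by rw [WedgePair.card_Xset])
  · exact hc.le

/-- **THE LOCAL IDENTITY `q_f(o) + q_f(ō) + m·z(o) + |o| = m`**: a proper `X`-source (`q`-part `m − |t|`) and its reversal (a proper
`Y`-source, `q`-part `0`) exchange their `q`-parts; the empty source (`z = 1`) and the top collapse `X` (`|t| = m`) are fixed with
`q`-part `0`. -/
theorem lqf_add_lqf_oinv (o : Opt m) : lqf m o + lqf m (oinv o) + m * lz m o + (o.1).card = m := by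
  have hle := card_le_of_opt o
  have e1 : lqf m o = if o.1 ⊆ Xs m ∧ o.1 ≠ ∅ then m - (o.1).card else 0 := rfl
  have e2 : lqf m (oinv o) = if linv m o.1 ⊆ Xs m ∧ linv m o.1 ≠ ∅ then m - (linv m o.1).card else 0 := rfl
  have e3 : lz m o = if o.1 = ∅ then 1 else 0 := rfl
  by_cases h0 : o.1 = ∅
  · -- the empty source: fixed, `q`-parts `0`, `z = 1`
    have hnp : ¬ (0 < (o.1).card ∧ (o.1).card < m) := fun h => by rw [h0, Finset.card_empty] at h; omega
    rw [e1, e2, e3, if_neg (fun h => h.2 h0), linv_of_not_proper hnp, if_neg (fun h => h.2 h0), if_pos h0, h0, Finset.card_empty]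
    omega
  · have hpos : 0 < (o.1).card := Nat.pos_of_ne_zero fun h => h0 (Finset.card_eq_zero.mp h)
    rw [e3, if_neg h0, mul_zero, add_zero]
    by_cases hp : (o.1).card < m
    · -- a proper source: reversed
      have hpr : 0 < (o.1).card ∧ (o.1).card < m := ⟨hpos, hp⟩
      have hne' : lrev o.1 ≠ ∅ := fun h => by
        have := congr_arg Finset.card h
        rw [card_lrev, Finset.card_empty] at this
        omega
      rw [e1, e2, linv_of_proper hpr, card_lrev]
      rcases mem_optSet.mp o.2 with hX | ⟨hY, -⟩
      · rw [if_pos ⟨hX, h0⟩, if_neg (fun h => not_subset_Xs_of_subset_Ys (lrev_subset_Ys hX) hne' h.1)]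
        omega
      · rw [if_neg (fun h => not_subset_Xs_of_subset_Ys hY h0 h.1), if_pos ⟨lrev_subset_Xs hY, hne'⟩]
        omega
    · -- the top collapse (`|t| = m`): fixed, `q`-parts `0`
      have hm' : (o.1).card = m := le_antisymm hle (not_lt.mp hp)
      have hnp : ¬ (0 < (o.1).card ∧ (o.1).card < m) := fun h => hp h.2
      rw [e1, e2, linv_of_not_proper hnp, hm']
      split_ifs <;> omega

/-! ## §3. The involution on option data: degree and empty blocks preserved, `q_f + q̄_f + mz + k = mn` -/

/-- the INVOLUTION ON OPTION DATA: the local involution on every block. -/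
def finv (f : Fin n → Opt m) : Fin n → Opt m := fun i => oinv (f i)

/-- it is an involution. -/
lemma finv_finv (f : Fin n → Opt m) : finv (finv f) = f := funext fun i => oinv_oinv (f i)

/-- hence injective. -/
lemma finv_injective : Function.Injective (finv (m := m) (n := n)) :=
  Function.LeftInverse.injective finv_finv

/-- it preserves the degree. -/
lemma kf_finv (f : Fin n → Opt m) : kf (finv f) = kf f := Finset.sum_congr rfl fun i _ => card_oinv (f i)

/-- it preserves the number of empty blocks. -/
lemma zf_finv (f : Fin n → Opt m) : zf (finv f) = zf f := Finset.sum_congr rfl fun i _ => lz_oinv (f i)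

/-- **`q_f(f) + q_f(f̄) + m·z(f) + k(f) = mn`** (the local identity summed over the blocks). -/
theorem qff_add_qff_finv (f : Fin n → Opt m) : qff f + qff (finv f) + m * zf f + kf f = m * n := by
  calc qff f + qff (finv f) + m * zf f + kf f
      = ∑ i, (lqf m (f i) + lqf m (oinv (f i)) + m * lz m (f i) + ((f i).1).card) := by
        simp only [qff, zf, kf, finv, Finset.sum_add_distrib, Finset.mul_sum]
    _ = ∑ _i : Fin n, m := Finset.sum_congr rfl fun i _ => lqf_add_lqf_oinv (f i)
    _ = m * n := by rw [Finset.sum_const, Finset.card_univ, Fintype.card_fin, smul_eq_mul, mul_comm]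

/-- **the class of `f` reaches block `q` iff the class of `f̄` reaches block `mn − k − q`** (one direction; shift `j ↦ z − j`). -/
theorem finv_mem_Fset {f : Fin n → Opt m} {k q : ℕ} (h : f ∈ Fset m n k q) : finv f ∈ Fset m n k (m * n - k - q) := by
  obtain ⟨hk, j, hj, hjq⟩ := mem_Fset.mp h
  have hid := qff_add_qff_finv f
  have e : m * j + m * (zf f - j) = m * zf f := by rw [← mul_add, Nat.add_sub_cancel' hj]
  refine mem_Fset.mpr ⟨by rw [kf_finv, hk], zf f - j, by rw [zf_finv]; exact Nat.sub_le _ _, ?_⟩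
  omega

/-- **THE PALINDROME ON THE CLASSES**: for `q ≤ mn − k`, the degree-`k` classes reaching block `mn − k − q` are the involution's
images of those reaching block `q`. -/
theorem map_finv_Fset {k q : ℕ} (hq : q ≤ m * n - k) :
    (Fset m n k q).map ⟨finv, finv_injective⟩ = Fset m n k (m * n - k - q) := by
  ext F
  rw [Finset.mem_map]
  constructor
  · rintro ⟨f, hf, rfl⟩
    exact finv_mem_Fset hf
  · intro hF
    refine ⟨finv F, ?_, finv_finv F⟩
    have h := finv_mem_Fset hF
    rwa [show m * n - k - (m * n - k - q) = q by omega] at h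

/-- so the two blocks are reached by the same number of classes. -/
theorem card_Fset_symm {k q : ℕ} (hq : q ≤ m * n - k) : (Fset m n k (m * n - k - q)).card = (Fset m n k q).card := by
  rw [← map_finv_Fset hq, Finset.card_map]

/-- **no class of degree `k` reaches a block of index `> mn − k`.** -/
theorem Fset_eq_empty_of_add_lt {k q : ℕ} (h : m * n < k + q) : Fset m n k q = ∅ := by
  rw [Finset.eq_empty_iff_forall_notMem]
  intro f hf
  obtain ⟨hk, j, hj, hjq⟩ := mem_Fset.mp hf
  have hid := qff_add_qff_finv f
  have e : m * j + m * (zf f - j) = m * zf f := by rw [← mul_add, Nat.add_sub_cancel' hj]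
  omega

/-! ## §4. THE PALINDROME OF THE BLOCK RANKS, every `m ≥ 1`, `n`, `k` -/

/-- **SERRE-TYPE PALINDROME OF THE BLOCK RANKS, UNIFORM IN `n` AND `m`.**  For every field `K`, every `m ≥ 1`, every `n`, every
degree `k`, every `q ≤ mn − k` and `a, c ≠ 0`: the blocks `q` and `mn − k − q` of `θ ↦ θ ∧ F` on `⋀^k K^{(m+m)n}` (`F` the `n`-fold
box of `m`-dimensional point pairs) have the same rank — in th-7 §G's `η`-weights `w = mn − k − 2q` the blocks of weights `w` and
`−w` have the same rank (the two-factor case, in th-7's `WedgeBox` model with factor dimension written `n` there: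
`WedgeBoxPerQOverlap.finrank_range_blockProj_symm`, `q ↔ 2n − k − q`). -/
theorem finrank_range_blockProj_wedge_pairBox_symm (hm : 1 ≤ m) {a c : K} (ha : a ≠ 0) (hc : c ≠ 0) {k q : ℕ}
    (hq : q ≤ m * n - k) :
    finrank K (LinearMap.range (blockProj K m n (m * n - k - q) ∘ₗ
        wedge K (Fin ((m + m) * n)) k (pairBox K (m := m) (n := n) a c))) =
      finrank K (LinearMap.range (blockProj K m n q ∘ₗ wedge K (Fin ((m + m) * n)) k (pairBox K (m := m) (n := n) a c))) := by
  rw [finrank_range_blockProj_wedge_pairBox_eq_card K hm ha hc, finrank_range_blockProj_wedge_pairBox_eq_card K hm ha hc,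
    card_Fset_symm hq]

/-- **the blocks of index `> mn − k` are zero in degree `k`** (`m ≥ 1`, `a, c ≠ 0`): the per-`q` ranks of degree `k` live on
`0 ≤ q ≤ mn − k`, i.e. on the `η`-weights `−(mn − k) ≤ w ≤ mn − k` of the parity of `mn − k`. -/
theorem finrank_range_blockProj_wedge_pairBox_eq_zero_of_add_lt (hm : 1 ≤ m) {a c : K} (ha : a ≠ 0) (hc : c ≠ 0) {k q : ℕ}
    (h : m * n < k + q) :
    finrank K (LinearMap.range (blockProj K m n q ∘ₗ wedge K (Fin ((m + m) * n)) k (pairBox K (m := m) (n := n) a c))) = 0 := by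
  rw [finrank_range_blockProj_wedge_pairBox_eq_card K hm ha hc, Fset_eq_empty_of_add_lt h, Finset.card_empty]

/-! ## §5. The same as arithmetic of the enumerator `genCount` / `G_{m,n}` -/

/-- **`genCount m n k (mn − k − q) = genCount m n k q`** for `q ≤ mn − k` (`m ≥ 1`): p10's corrected enumerator
(`FormulaNPerQUniform.genCount`) is a palindrome in `q` about `(mn − k)/2`, by the involution on the classes (`card_Fset`). -/
theorem genCount_symm (hm : 1 ≤ m) {n k q : ℕ} (hq : q ≤ m * n - k) :
    FormulaN.Uniform.genCount m n k (m * n - k - q) = FormulaN.Uniform.genCount m n k q := by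
  rw [← card_Fset hm, ← card_Fset hm, card_Fset_symm hq]

/-- **`genCount m n k q = 0` for `k + q > mn`** (`m ≥ 1`). -/
theorem genCount_eq_zero_of_add_lt (hm : 1 ≤ m) {n k q : ℕ} (h : m * n < k + q) : FormulaN.Uniform.genCount m n k q = 0 := by
  rw [← card_Fset (n := n) hm, Fset_eq_empty_of_add_lt h, Finset.card_empty]

/-- the generating-function form: **`[t^k u^{mn−k−q}] G_{m,n}(t,u) = [t^k u^q] G_{m,n}(t,u)`** for `q ≤ mn − k` (`m ≥ 1`). -/
theorem coeff_genGen_symm (hm : 1 ≤ m) {n k q : ℕ} (hq : q ≤ m * n - k) :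
    ((FormulaN.Uniform.genGen m n).coeff k).coeff (m * n - k - q) = ((FormulaN.Uniform.genGen m n).coeff k).coeff q := by
  rw [FormulaN.Uniform.coeff_genGen hm n k, FormulaN.Uniform.coeff_genGen hm n k, genCount_symm hm hq]

/-- the pre-registered `m = 3`, `n = 3` rows read as palindromes (`mn = 9`): degree 1 about `q = 4`, degree 2 about `q = 7/2`,
degree 3 about `q = 3` — e.g. `genCount 3 3 2 (7 − q) = genCount 3 3 2 q` for `q ≤ 7`, and `genCount 3 3 2 8 = genCount 3 3 2 9 = 0`. -/
theorem genCount_symm_threefold_triple :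
    (∀ q, q ≤ 7 → FormulaN.Uniform.genCount 3 3 2 (7 - q) = FormulaN.Uniform.genCount 3 3 2 q) ∧
      FormulaN.Uniform.genCount 3 3 2 8 = 0 ∧ FormulaN.Uniform.genCount 3 3 2 9 = 0 := by
  refine ⟨fun q hq => ?_, genCount_eq_zero_of_add_lt (n := 3) (by norm_num) (by norm_num),
    genCount_eq_zero_of_add_lt (n := 3) (by norm_num) (by norm_num)⟩
  have h := genCount_symm (show 1 ≤ 3 by norm_num) (n := 3) (k := 2) (q := q) (by omega)
  rwa [show 3 * 3 - 2 - q = 7 - q by omega] at h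

end Summit.Ventures.HSemireg.Wedge.PairPowers
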